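import Literature.NumberTheory.LFunctions.WeilZeroSum
import Mathlib
import HarnessLib

/-!
# HANDOFF — a GENERIC WINDOW for the dodger: the mollifier radius can be chosen so that no node `z_ρ` of a zero of `ζ` lies on the lattice `πk/b` (rh-explicit, track «HANDOFF», seat prove-2 gen9, ATTEMPT-18 §3 (R-1′))

HONEST FRAMING. Nothing here bears on the truth of RH; this is a countability remark. The A1-link of the kernel dodger programme
(`HandoffDodgerWitnessLink.weilMellin_dodger_eq`, `HandoffDodgerWitnessAtZeros`) evaluates the dodger's transform at a zero `ρ` through its node
`z_ρ = Im ρ + i(½ − Re ρ)` under the side condition `z_ρ ∉ {ℓ_1, …, ℓ_K}`, `ℓ_k = πk/b`, which fails only if `Re ρ = ½` and `Im ρ = πk/b` exactly.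
In ATTEMPT-16 the half-width is `b = L/2 − ε` with the mollifier radius `ε` free in a small interval. THIS FILE shows the side condition can be
MET by that choice (`exists_generic_shift`): for any `L`, `ε₀ > 0` there is `ε ∈ [ε₀, 2ε₀]` such that for EVERY zero `ρ` of `ζ` off the real axis and
EVERY `k ∈ ℕ`, `z_ρ ≠ π(k+1)/(L/2 − ε)` — because the exceptional `ε` form a countable set (one per pair (ρ, k); the zeros are countable, tree
`riemannZetaNontrivialZeros_countable`) of Lebesgue measure zero, while `[ε₀, 2ε₀]` has measure `ε₀ > 0`. No `sorry`, standard axioms, no definitions.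

References: this track (ATTEMPT-18 §3 (R-1′)).
-/

set_option linter.dupNamespace false

noncomputable section

open Complex Set MeasureTheory
open scoped Real

namespace Summit.RiemannHypothesis.RiemannHypothesis.Theorems.Handoff

open Literature.NumberTheory.LFunctions

/-- The exceptional shifts for one pair `(ρ, k)`: if `Im ρ + i(½ − Re ρ) = π(k+1)/(L/2 − ε)` then `ε = L/2 − π(k+1)/Im ρ` (`Im ρ ≠ 0`). [folklore] -/
theorem shift_eq_of_node_eq_lattice {L ε : ℝ} {ρ : ℂ} (hρ : ρ.im ≠ 0) {k : ℕ}
    (h : ((ρ.im : ℝ) : ℂ) + ((1 / 2 - ρ.re : ℝ) : ℂ) * I = ((π * ((k + 1 : ℕ) : ℝ) / (L / 2 - ε) : ℝ) : ℂ)) :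
    ε = L / 2 - π * ((k + 1 : ℕ) : ℝ) / ρ.im := by
  have hre := congrArg Complex.re h
  simp only [Complex.add_re, Complex.ofReal_re, Complex.mul_re, Complex.I_re, Complex.ofReal_im, Complex.I_im, mul_zero,
    mul_one, sub_self, add_zero] at hre
  -- `hre : ρ.im = π(k+1)/(L/2 − ε)`
  have hden : L / 2 - ε ≠ 0 := by
    intro h0; rw [h0, div_zero] at hre; exact hρ hre
  -- multiply out: `ρ.im·(L/2 − ε) = π(k+1)`, then divide by `ρ.im`
  have h1 : ρ.im * (L / 2 - ε) = π * ((k + 1 : ℕ) : ℝ) := by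
    rw [hre, div_mul_cancel₀ _ hden]
  have h2 : L / 2 - ε = π * ((k + 1 : ℕ) : ℝ) / ρ.im := by
    rw [eq_div_iff hρ]; linarith [h1]
  linarith [h2]

/-- **A generic mollifier radius exists.** For every `L` and `ε₀ > 0` there is `ε ∈ [ε₀, 2ε₀]` such that no node of a zero of `ζ` off the real
axis lies on the lattice of half-width `b = L/2 − ε`: `Im ρ + i(½ − Re ρ) ≠ π(k+1)/(L/2 − ε)` for all such `ρ` and all `k`.
[this track, ATTEMPT-18 (R-1′)] -/
theorem exists_generic_shift (L : ℝ) {ε₀ : ℝ} (hε₀ : 0 < ε₀) :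
    ∃ ε ∈ Icc ε₀ (2 * ε₀), ∀ ρ : ℂ, riemannZeta ρ = 0 → ρ.im ≠ 0 → ∀ k : ℕ,
      ((ρ.im : ℝ) : ℂ) + ((1 / 2 - ρ.re : ℝ) : ℂ) * I ≠ ((π * ((k + 1 : ℕ) : ℝ) / (L / 2 - ε) : ℝ) : ℂ) := by
  -- the exceptional set
  set B : Set ℝ := ⋃ ρ ∈ ZetaZeros.riemannZetaNontrivialZeros, ⋃ k : ℕ, {L / 2 - π * ((k + 1 : ℕ) : ℝ) / ρ.im} with hB
  have hBc : B.Countable := by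
    refine Set.Countable.biUnion riemannZetaNontrivialZeros_countable fun ρ _ => ?_
    exact Set.countable_iUnion fun k => Set.countable_singleton _
  have hB0 : volume B = 0 := hBc.measure_zero volume
  -- the interval has positive measure, so it is not contained in `B`
  have hI : volume (Icc ε₀ (2 * ε₀)) = ENNReal.ofReal ε₀ := by
    rw [Real.volume_Icc]; congr 1; ring
  have hpos : 0 < volume (Icc ε₀ (2 * ε₀)) := by rw [hI]; exact ENNReal.ofReal_pos.2 hε₀
  have hnot : ¬ Icc ε₀ (2 * ε₀) ⊆ B := fun h => by
    have := measure_mono_null h hB0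
    rw [this] at hpos; exact lt_irrefl _ hpos
  obtain ⟨ε, hεI, hεB⟩ := Set.not_subset.1 hnot
  refine ⟨ε, hεI, fun ρ hζ him k h => hεB ?_⟩
  have hmem : ρ ∈ ZetaZeros.riemannZetaNontrivialZeros := ZetaZeros.riemannZetaNontrivialZeros.mem_of_im_ne_zero hζ him
  rw [hB]
  refine Set.mem_iUnion₂.2 ⟨ρ, hmem, Set.mem_iUnion.2 ⟨k, ?_⟩⟩
  exact shift_eq_of_node_eq_lattice him h

end Summit.RiemannHypothesis.RiemannHypothesis.Theorems.Handoff

end
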